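import Summits.BirchSwinnertonDyer.BirchSwinnertonDyer.Theorems.KimAtThreeD7uUnramifiedMembershipCyclotomic
import HarnessLib

/-!
# THEOREM D-u for EVERY ODD `p` — Kolyvagin systems at TWO depths with (COMP) from ONE Euler system of
# `T_pE/ℚ` unramified away from `p`, rows WITH ANOMALOUS bad places INCLUDED and NO thinning of the
# Kolyvagin primes (cell `bsd-addord`, seat w2-tamdiv gen 2; route W2 `KimAtThreeKolyvagin`, crux 19560
# `KatoKuriharaPortThreeShared`, residual (C3) = the anomalous bad places / TamDiv∞ = [MR04] Remark A.5)

HONEST FRAMING: TOOL theorem (no definition, no named fact, no `sorry`); closes nothing by itself;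
nothing is booked; BSD is not proved by any of this.

## What

w2-c3 g5's THEOREM D-u `KimAtThreeDeepUpperKolyvaginPair.exists_isKolyvaginSystem_pair_propagatedSelmerStructure_of_unramified`
(n1011-p13's D7-b `Derivative.Rat.exists_isKolyvaginSystem_pair_propagatedSelmerStructure_of_primes''` with the
prime-thinning `hP″`/`hP″₂` REPLACED by the (C2) clause of Kato's matrix `ZetaBody` — every class `c_{i,r}`
unramified away from `p` at class level, Kato (8.1.3) `z_m ∈ H¹(ℤ[ζ_m, 1/p], T)`, §8.2, Lemma 8.5) is
stated at `p = 3` ONLY, because its local clause at the non-good places went through U4 + the level-`k`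
stable range `PropagatedConditionStableRangeThree`, typed at `3` (its docstring: «a general-`p` twin of
that file gives general `p` verbatim»).  **`exists_isKolyvaginSystem_pair_propagatedSelmerStructure_of_unramified_odd`**
is that theorem for EVERY ODD PRIME `p` (D7-b's `hp2 : p ≠ 2` restored; every other binder and the whole
conclusion token for token with `3 ↦ p`): the local clause at every place `w ∤ p`, `w ∉ d` not of good
reduction is fed by the `𝓕_u` road
`KimAtThreeD7uUnramifiedMembershipCyclotomic.localization_mem_propagatedSelmerStructure_of_res_eq_deriv_of_unramified`
(THEOREM B-u `KimAtThreeDeepUpperBadPlaceDescent` + the profinite unramified `H¹` of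
`HOneUnramifiedProcyclic` / `KimAtThreeDeepUpperOffStratumLocalIndex` §2 — [MR04] Remark A.5
«`κ_n ∈ H¹_{(𝓕_u)_n}`» — which needs NO stable range), its Kolyvagin-prime inputs (`ℓ − 1` and `P_ℓ(1)`
kill `T′`, ramification of the levels, Frobenii) discharged from `Kato.IsKolyvaginPrime` and the tree
exactly as at `3`.  So: for every odd `p`, an Euler system of `T_pE` over Kato's cyclotomic levels that is
unramified away from `p` yields Mazur–Rubin Kolyvagin systems for `𝓕_can` at any two depths `k ≤ m`,
compatible under reduction, with NO hypothesis at the bad places of `E` ([MR04] Thm. 3.2.4 + Prop. A.2 +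
Remark A.5 for `T_pE`, in the tree's currency; the place `p` stays the displayed `htop`/`htop″`).

HONEST LIMITS: no Euler system asserted; `htop`/`htop″` at `p` displayed (discharged in the tree at
`p = 3` on the rows of the W2 route by w2-c3's END files); values not here; closes nothing by itself.

References: B. Mazur, K. Rubin, Mem. AMS 799 (2004), Def. 3.2.1, Thm. 3.2.4, App. A Prop. A.2 and
Remark A.5; K. Rubin, *Euler Systems* (2000) Def. 4.4.4, Lemma 1.3.2, Lemma 4.4.2, Thm. 4.5.1, 4.5.4;
K. Rubin, PCMI 18 (2011) §3.1; K. Kato, Astérisque 295 (2004) (8.1.3), §8.2, Lemma 8.5;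
K. Büyükboduk, J. Number Theory 129 (2009) Thm. 3.1.
-/

noncomputable section

-- the cell's Theorems namespace `Summit.BirchSwinnertonDyer.BirchSwinnertonDyer.…` repeats the summit name by design (D-0017)
set_option linter.dupNamespace false

open CategoryTheory Function Finset Polynomial Field IsDedekindDomain
open scoped NumberField Classical ContRepresentation
open Literature.NumberTheory.GaloisRepresentations Literature.NumberTheory.EllipticCurves
open Literature.NumberTheory.GaloisRepresentations.DiscreteGaloisModule
open Literature.NumberTheory.GaloisCohomology
open Summit.BirchSwinnertonDyer.Rank1Residual.GaloisImage
open Summit.BirchSwinnertonDyer.Rank1Residual.GaloisImage.CoeffTransport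
open Summit.BirchSwinnertonDyer.Rank1Residual.GaloisImage.CyclotomicLevel
open Summit.BirchSwinnertonDyer.Rank1Residual.GaloisImage.Derivative
open Summit.BirchSwinnertonDyer.Rank1Residual.GaloisImage.Derivative.Rat
open Summit.BirchSwinnertonDyer.BirchSwinnertonDyer.Theorems.KimAtThreeDeepUpperBadPlaceClause hiding
  localization_mem_propagatedSelmerStructure_of_res_eq_deriv_of_unramified
open Summit.BirchSwinnertonDyer.BirchSwinnertonDyer.Theorems.KimAtThreeD7uUnramifiedMembershipCyclotomic
open Rat.HeightOneSpectrum WeierstrassCurve TateModule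

namespace Summit.BirchSwinnertonDyer.BirchSwinnertonDyer.Theorems.KimAtThreeD7uKolyvaginPairOdd

variable (W : WeierstrassCurve ℚ) [W.IsElliptic] [W.IsGloballyMinimal] (p : ℕ) [Fact p.Prime]
variable [Module.Free ℤ_[p] (W.tateModule p)] [Module.Finite ℤ_[p] (W.tateModule p)]
  [ContinuousSMul ℤ_[p] (W.tateModule p)]

/-- Local notation: `T∞ = T_p E` as a continuous `G_ℚ`-representation. -/
local notation3 "T∞" => WeierstrassCurve.tateGaloisRep W p (W.continuous_galoisRepTate_holds p)

/-- Local notation: `𝐫⟦f, T′, U⟧ = f_* : H¹(U, T_pE) → H¹(U, T′)`. -/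
local notation3 (prettyPrint := false) "𝐫⟦" f ", " Tg ", " U "⟧" =>
  ContinuousCohomology.map (ContinuousMonoidHom.id _)
    (X := subgroupRep (ContinuousRep.toTopRep T∞) U)
    (Y := subgroupRep (ContinuousRep.toTopRep Tg) U)
    ((TopRep.resFunctor (Subgroup.subtype U)).map f) 1

variable (S : Set (HeightOneSpectrum (𝓞 ℚ)))

/-- Local notation: `𝓛` = the cyclotomic Euler-system levels `ℚ(μ_{p^{n+1}}, μ_r)`, `r ∩ S = ∅`. -/
local notation3 "𝓛" => cyclotomicLevelsRat p S

/-- Local notation: `𝐃⟦A, X, U, τ⟧ ℓ = ∑_{j < ℓ−1} j·(τ_ℓ)_*^j`, Kolyvagin's derivative operator. -/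
local notation3 (prettyPrint := false) "𝐃⟦" A ", " X ", " U ", " τ "⟧" =>
  fun ℓ : HeightOneSpectrum (𝓞 ℚ) =>
  ∑ j ∈ Finset.range (((primesEquiv ℓ : Nat.Primes) : ℕ) - 1),
    (j : Module.End A (continuousCohomology 1 (subgroupRep X U))) *
      (conjMap X U ((τ : HeightOneSpectrum (𝓞 ℚ) → absoluteGaloisGroup ℚ) ℓ) 1).hom.toLinearMap ^ j

/-- **THEOREM D-u at TWO depths with (COMP), every ODD `p`** (rows WITH anomalous bad places allowed,
NO thinning of the Kolyvagin primes): every binder of w2-c3's `p = 3` theorem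
`KimAtThreeDeepUpperKolyvaginPair.exists_isKolyvaginSystem_pair_propagatedSelmerStructure_of_unramified`
with `3 ↦ p` and D7-b's `hp2 : p ≠ 2` restored; `hur` = the (C2) clause of `ZetaBody` (each `c_{i,r}`
unramified away from `p` at class level); `htop`, `htop″` at `p` unchanged.  Conclusion identical to
D7-b's: ONE `σ`, transports `Φ_r`, `Φ″_r`, the two families with `D.IsKolyvaginSystem (𝓕_can,k) κ`,
`D″.IsKolyvaginSystem (𝓕_can,m) κ″`, the derivative characterisations, and `π_* (κ″ d) = κ d` on the
common levels.  The local clause at every place `w ∤ p`, `w ∉ d` that is not of good reduction is the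
`𝓕_u` road `KimAtThreeD7uUnramifiedMembershipCyclotomic.localization_mem_propagatedSelmerStructure_of_res_eq_deriv_of_unramified`
(THEOREM B-u + the profinite unramified `H¹`; no stable range, hence every `p`).
[cite: MazurRubin2004, Def. 3.2.1, Thm. 3.2.4 and App. A Remark A.5 (p. 81)]
[cite: Rubin2000, Def. 4.4.4, Lemma 4.4.2, Thm. 4.5.1] [cite: Rubin2011, §3.1 (p. 29)]
[cite: Kato2004Asterisque, (8.1.3) (p. 180) and Lemma 8.5] -/
theorem exists_isKolyvaginSystem_pair_propagatedSelmerStructure_of_unramified_odd (hp2 : p ≠ 2)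
    {k m : ℕ} (hkm : k ≤ m)
    {c : ∀ (i : ℕ) (r : (𝓛).Ideals), H1 T∞ ((𝓛).level i r.1)}
    (hc : IsEulerSystem 𝓛 T∞ p c)
    -- depth `k`
    {M' : Type} [AddCommGroup M'] [Module ℤ_[p] M'] [TopologicalSpace M'] [DiscreteTopology M']
    [IsTopologicalAddGroup M'] [ContinuousSMul ℤ_[p] M'] {T' : GaloisRep ℚ ℤ_[p] M'}
    (red : T∞.toTopRep ⟶ T'.toTopRep) (hred : Function.Surjective red.hom)
    (hM : ∀ x : M', (((p : ℕ) : ℤ_[p]) ^ (k + 1)) • x = 0)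
    (e : M' →+ WeierstrassCurve.geomTorsion W (((p : ℕ) : ℤ) ^ k * ((p : ℕ) : ℤ))) (hec : Continuous e)
    (he : ∀ (g : absoluteGaloisGroup ℚ) (x : M'),
      e (T'.toTopRep.ρ g x) = (W.torsionGaloisModule (((p : ℕ) : ℤ) ^ k * ((p : ℕ) : ℤ))).toTopRep.ρ g (e x))
    (einv : WeierstrassCurve.geomTorsion W (((p : ℕ) : ℤ) ^ k * ((p : ℕ) : ℤ)) →+ M') (hic : Continuous einv)
    (h₁ : ∀ x, einv (e x) = x) (h₂ : ∀ y, e (einv y) = y)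
    (hcomp : ∀ a : W.tateModule p,
      ((e (red.hom a) : geomTorsion W (((p : ℕ) : ℤ) ^ k * ((p : ℕ) : ℤ))) : geomPoints W) = proj p (k + 1) a)
    -- depth `m`
    {M'' : Type} [AddCommGroup M''] [Module ℤ_[p] M''] [TopologicalSpace M''] [DiscreteTopology M'']
    [IsTopologicalAddGroup M''] [ContinuousSMul ℤ_[p] M''] {T'' : GaloisRep ℚ ℤ_[p] M''}
    (red'' : T∞.toTopRep ⟶ T''.toTopRep) (hred'' : Function.Surjective red''.hom)
    (hM'' : ∀ x : M'', (((p : ℕ) : ℤ_[p]) ^ (m + 1)) • x = 0)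
    (e'' : M'' →+ WeierstrassCurve.geomTorsion W (((p : ℕ) : ℤ) ^ m * ((p : ℕ) : ℤ))) (hec'' : Continuous e'')
    (he'' : ∀ (g : absoluteGaloisGroup ℚ) (x : M''),
      e'' (T''.toTopRep.ρ g x) = (W.torsionGaloisModule (((p : ℕ) : ℤ) ^ m * ((p : ℕ) : ℤ))).toTopRep.ρ g (e'' x))
    (einv'' : WeierstrassCurve.geomTorsion W (((p : ℕ) : ℤ) ^ m * ((p : ℕ) : ℤ)) →+ M'') (hic'' : Continuous einv'')
    (h₁'' : ∀ x, einv'' (e'' x) = x) (h₂'' : ∀ y, e'' (einv'' y) = y)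
    (hcomp'' : ∀ a : W.tateModule p,
      ((e'' (red''.hom a) : geomTorsion W (((p : ℕ) : ℤ) ^ m * ((p : ℕ) : ℤ))) : geomPoints W) = proj p (m + 1) a)
    (π : (W.torsionGaloisModule (((p : ℕ) : ℤ) ^ m * ((p : ℕ) : ℤ))).toContRepresentation →ⁱL
      (W.torsionGaloisModule (((p : ℕ) : ℤ) ^ k * ((p : ℕ) : ℤ))).toContRepresentation)
    (hπ : ∀ x : geomTorsion W (((p : ℕ) : ℤ) ^ m * ((p : ℕ) : ℤ)),
      ((π x : geomTorsion W (((p : ℕ) : ℤ) ^ k * ((p : ℕ) : ℤ))) : geomPoints W) =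
        (((p : ℕ) : ℤ) ^ (m - k)) • (x : geomPoints W))
    -- the curve and the two datums (same primitive roots `η`)
    (hirr : W.HasIrreducibleModPGaloisRep p)
    (D : KolyvaginDatum (W.torsionGaloisModule (((p : ℕ) : ℤ) ^ k * ((p : ℕ) : ℤ))))
    (hT : D.transverse = cyclotomicTransverse (W.torsionGaloisModule (((p : ℕ) : ℤ) ^ k * ((p : ℕ) : ℤ))))
    (D'' : KolyvaginDatum (W.torsionGaloisModule (((p : ℕ) : ℤ) ^ m * ((p : ℕ) : ℤ))))
    (hT'' : D''.transverse = cyclotomicTransverse (W.torsionGaloisModule (((p : ℕ) : ℤ) ^ m * ((p : ℕ) : ℤ))))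
    {η : (ℓ : HeightOneSpectrum (𝓞 ℚ)) → (ZMod (Ideal.absNorm ℓ.asIdeal))ˣ}
    (hD : D.HasCanonicalComparison (p ^ (k + 1)) η) (hD'' : D''.HasCanonicalComparison (p ^ (m + 1)) η)
    (hPr : D.primes ⊆ (𝓛).primes) (hPr'' : D''.primes ⊆ (𝓛).primes)
    (hKol : ∀ ℓ ∈ D.primes, Kato.IsKolyvaginPrime W p (k + 1) ((primesEquiv ℓ : Nat.Primes) : ℕ))
    (hKol'' : ∀ ℓ ∈ D''.primes, Kato.IsKolyvaginPrime W p (m + 1) ((primesEquiv ℓ : Nat.Primes) : ℕ))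
    -- (C2): every class of the Euler system is UNRAMIFIED AWAY FROM `p` at class level (`ZetaBody` (C2))
    (hur : ∀ (i : ℕ) (r : (𝓛).Ideals) (v : HeightOneSpectrum (𝓞 ℚ)), ((primesEquiv v : Nat.Primes) : ℕ) ≠ p →
      ∀ 𝔓 ∈ v.primesAbove,
        resLe (T∞).toTopRep
          (inf_le_left : (𝓛).level i r.1 ⊓ 𝔓.inertia (absoluteGaloisGroup ℚ) ≤ (𝓛).level i r.1) 1 (c i r) = 0)
    (htop : ∀ w : HeightOneSpectrum (𝓞 ℚ), ((primesEquiv w : Nat.Primes) : ℕ) = p →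
      propagatedSelmerStructure W p k (Sum.inr w) = ⊤)
    (htop'' : ∀ w : HeightOneSpectrum (𝓞 ℚ), ((primesEquiv w : Nat.Primes) : ℕ) = p →
      propagatedSelmerStructure W p m (Sum.inr w) = ⊤) :
    ∃ (σ : HeightOneSpectrum (𝓞 ℚ) → absoluteGaloisGroup ℚ)
      (Φ : ∀ r : Finset (HeightOneSpectrum (𝓞 ℚ)),
        continuousCohomology 1 (subgroupRep T'.toTopRep ((𝓛).level ⊥ r)) →+
          continuousCohomology 1 (subgroupRep
            (W.torsionGaloisModule (((p : ℕ) : ℤ) ^ k * ((p : ℕ) : ℤ))).toTopRep ((𝓛).level ⊥ r)))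
      (comm : ∀ r : Finset (HeightOneSpectrum (𝓞 ℚ)),
        ((r : Finset _) : Set (HeightOneSpectrum (𝓞 ℚ))).Pairwise fun a b =>
          Commute (𝐃⟦ℤ, (W.torsionGaloisModule (((p : ℕ) : ℤ) ^ k * ((p : ℕ) : ℤ))).toTopRep, ((𝓛).level ⊥ r), σ⟧ a)
            (𝐃⟦ℤ, (W.torsionGaloisModule (((p : ℕ) : ℤ) ^ k * ((p : ℕ) : ℤ))).toTopRep, ((𝓛).level ⊥ r), σ⟧ b))
      (κ : Finset (HeightOneSpectrum (𝓞 ℚ)) → galoisCohomology (W.torsionGaloisModule (((p : ℕ) : ℤ) ^ k * ((p : ℕ) : ℤ))) 1)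
      (Φ'' : ∀ r : Finset (HeightOneSpectrum (𝓞 ℚ)),
        continuousCohomology 1 (subgroupRep T''.toTopRep ((𝓛).level ⊥ r)) →+
          continuousCohomology 1 (subgroupRep
            (W.torsionGaloisModule (((p : ℕ) : ℤ) ^ m * ((p : ℕ) : ℤ))).toTopRep ((𝓛).level ⊥ r)))
      (comm'' : ∀ r : Finset (HeightOneSpectrum (𝓞 ℚ)),
        ((r : Finset _) : Set (HeightOneSpectrum (𝓞 ℚ))).Pairwise fun a b =>
          Commute (𝐃⟦ℤ, (W.torsionGaloisModule (((p : ℕ) : ℤ) ^ m * ((p : ℕ) : ℤ))).toTopRep, ((𝓛).level ⊥ r), σ⟧ a)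
            (𝐃⟦ℤ, (W.torsionGaloisModule (((p : ℕ) : ℤ) ^ m * ((p : ℕ) : ℤ))).toTopRep, ((𝓛).level ⊥ r), σ⟧ b))
      (κ'' : Finset (HeightOneSpectrum (𝓞 ℚ)) →
        galoisCohomology (W.torsionGaloisModule (((p : ℕ) : ℤ) ^ m * ((p : ℕ) : ℤ))) 1),
      (∀ ℓ, σ ℓ ∈ (adicCompletionPrime ℚ ℓ).inertia (absoluteGaloisGroup ℚ)) ∧
      (∀ ℓ, modNCyclotomicCharacter ℚ (Ideal.absNorm ℓ.asIdeal) (σ ℓ) = η ℓ) ∧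
      (∀ r, ∀ (φ : contOneCocycles (subgroupRep T'.toTopRep ((𝓛).level ⊥ r)))
        (ψ : contOneCocycles (subgroupRep
          (W.torsionGaloisModule (((p : ℕ) : ℤ) ^ k * ((p : ℕ) : ℤ))).toTopRep ((𝓛).level ⊥ r))),
        (∀ g, ψ.1 g = e (φ.1 g)) → Φ r (oneCocycleClass _ φ) = oneCocycleClass _ ψ) ∧
      (∀ r, ∀ (φ : contOneCocycles (subgroupRep T''.toTopRep ((𝓛).level ⊥ r)))
        (ψ : contOneCocycles (subgroupRep
          (W.torsionGaloisModule (((p : ℕ) : ℤ) ^ m * ((p : ℕ) : ℤ))).toTopRep ((𝓛).level ⊥ r))),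
        (∀ g, ψ.1 g = e'' (φ.1 g)) → Φ'' r (oneCocycleClass _ φ) = oneCocycleClass _ ψ) ∧
      D.IsKolyvaginSystem (propagatedSelmerStructure W p k) κ ∧
      D''.IsKolyvaginSystem (propagatedSelmerStructure W p m) κ'' ∧
      (∀ r : Finset (HeightOneSpectrum (𝓞 ℚ)), ¬ (↑r : Set _) ⊆ D.primes → κ r = 0) ∧
      (∀ r : Finset (HeightOneSpectrum (𝓞 ℚ)), ¬ (↑r : Set _) ⊆ D''.primes → κ'' r = 0) ∧
      (∀ (r : Finset (HeightOneSpectrum (𝓞 ℚ))) (hr : (↑r : Set _) ⊆ D.primes),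
        resSubgroup (W.torsionGaloisModule (((p : ℕ) : ℤ) ^ k * ((p : ℕ) : ℤ))).toTopRep ((𝓛).level ⊥ r) 1 (κ r) =
          (r.noncommProd 𝐃⟦ℤ, (W.torsionGaloisModule (((p : ℕ) : ℤ) ^ k * ((p : ℕ) : ℤ))).toTopRep, ((𝓛).level ⊥ r), σ⟧
            (comm r)) (Φ r (𝐫⟦red, T', ((𝓛).level ⊥ r)⟧
              (c ⊥ ⟨r, fun _ hq => hPr (hr (Finset.mem_coe.2 hq))⟩)))) ∧
      (∀ (r : Finset (HeightOneSpectrum (𝓞 ℚ))) (hr : (↑r : Set _) ⊆ D''.primes),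
        resSubgroup (W.torsionGaloisModule (((p : ℕ) : ℤ) ^ m * ((p : ℕ) : ℤ))).toTopRep ((𝓛).level ⊥ r) 1 (κ'' r) =
          (r.noncommProd 𝐃⟦ℤ, (W.torsionGaloisModule (((p : ℕ) : ℤ) ^ m * ((p : ℕ) : ℤ))).toTopRep, ((𝓛).level ⊥ r), σ⟧
            (comm'' r)) (Φ'' r (𝐫⟦red'', T'', ((𝓛).level ⊥ r)⟧
              (c ⊥ ⟨r, fun _ hq => hPr'' (hr (Finset.mem_coe.2 hq))⟩)))) ∧
      ∀ d : Finset (HeightOneSpectrum (𝓞 ℚ)), (↑d : Set _) ⊆ D.primes → (↑d : Set _) ⊆ D''.primes →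
        galoisCohomology.map π 1 (κ'' d) = κ d := by
  have hmk : ((p : ℕ) : ℤ) ^ k * ((p : ℕ) : ℤ) = ((p ^ (k + 1) : ℕ) : ℤ) := by push_cast; ring
  have hmm : ((p : ℕ) : ℤ) ^ m * ((p : ℕ) : ℤ) = ((p ^ (m + 1) : ℕ) : ℤ) := by push_cast; ring
  -- the pins in `tateToTorsion` form (T-DER-D4BN F1's `hcomp`)
  have hcompk : ∀ a : W.tateModule p, tateToTorsion W p k a = e (red.hom a) := fun a =>
    Subtype.ext (by rw [coe_tateToTorsion_apply]; exact (hcomp a).symm)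
  have hcompm : ∀ a : W.tateModule p, tateToTorsion W p m a = e'' (red''.hom a) := fun a =>
    Subtype.ext (by rw [coe_tateToTorsion_apply]; exact (hcomp'' a).symm)
  -- arithmetic Frobenii at every place; the Kolyvagin-prime data feeding THEOREM B-u at both depths
  have hFrex : ∀ ℓ : HeightOneSpectrum (𝓞 ℚ), ∃ Fr : absoluteGaloisGroup ℚ, IsArithFrobAtPlace ℚ ℓ Fr :=
    fun ℓ => (CyclotomicLevel.Rat.exists_isArithFrobAtPlace_mem_tameLevel p S ℓ).imp fun _ h => h.1
  choose Fr hFr using hFrex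
  have hramk : ∀ d : Finset (HeightOneSpectrum (𝓞 ℚ)), (↑d : Set _) ⊆ D.primes →
      ∀ ℓ ∈ d, ∀ s ⊆ d, ℓ ∉ s → ¬ SubgroupIsUnramifiedAt ℚ ((𝓛).level ⊥ (insert ℓ s)) ℓ :=
    fun d hd ℓ hℓ s _ _ =>
      CyclotomicLevel.Rat.not_subgroupIsUnramifiedAt_cyclotomicLevelsRat_level_insert p S ⊥
        (Derivative.Rat.ne_two_of_isKolyvaginPrime W p (Nat.succ_pos k)
          (hKol ℓ (hd (Finset.mem_coe.2 hℓ)))) s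
  have hramm : ∀ d : Finset (HeightOneSpectrum (𝓞 ℚ)), (↑d : Set _) ⊆ D''.primes →
      ∀ ℓ ∈ d, ∀ s ⊆ d, ℓ ∉ s → ¬ SubgroupIsUnramifiedAt ℚ ((𝓛).level ⊥ (insert ℓ s)) ℓ :=
    fun d hd ℓ hℓ s _ _ =>
      CyclotomicLevel.Rat.not_subgroupIsUnramifiedAt_cyclotomicLevelsRat_level_insert p S ⊥
        (Derivative.Rat.ne_two_of_isKolyvaginPrime W p (Nat.succ_pos m)
          (hKol'' ℓ (hd (Finset.mem_coe.2 hℓ)))) s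
  -- ONE generator family for both datums (D1 on `𝒫 ∪ 𝒫″`)
  obtain ⟨σ, hσI, hσχ, -, hσ⟩ := CyclotomicLevel.Rat.exists_sigma_mem_inertia_adicCompletionPrime p S η
    (D.primes ∪ D''.primes) (fun ℓ hℓ => hℓ.elim (fun h => hD.zpowers_eq_top h)
      (fun h => hD''.zpowers_eq_top h))
  have hσk : ∀ r : Finset (HeightOneSpectrum (𝓞 ℚ)), (↑r : Set _) ⊆ D.primes → _ :=
    fun r hr => hσ r (hr.trans Set.subset_union_left)
  have hσm : ∀ r : Finset (HeightOneSpectrum (𝓞 ℚ)), (↑r : Set _) ⊆ D''.primes → _ :=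
    fun r hr => hσ r (hr.trans Set.subset_union_right)
  -- `h0` at both depths from `Irr(E[p])`
  have h0k : ∀ r : Finset (HeightOneSpectrum (𝓞 ℚ)), (↑r : Set _) ⊆ D.primes →
      ∀ P : WeierstrassCurve.geomTorsion W (((p : ℕ) : ℤ) ^ k * ((p : ℕ) : ℤ)),
        (∀ u : (𝓛).level ⊥ r, (u : absoluteGaloisGroup ℚ) • P = P) → P = 0 :=
    fun r _ P hP => geomTorsion_eq_zero_of_fixed_level W p S hp2 hirr hmk ⊥ r P hP
  have h0m : ∀ r : Finset (HeightOneSpectrum (𝓞 ℚ)), (↑r : Set _) ⊆ D''.primes →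
      ∀ P : WeierstrassCurve.geomTorsion W (((p : ℕ) : ℤ) ^ m * ((p : ℕ) : ℤ)),
        (∀ u : (𝓛).level ⊥ r, (u : absoluteGaloisGroup ℚ) • P = P) → P = 0 :=
    fun r _ P hP => geomTorsion_eq_zero_of_fixed_level W p S hp2 hirr hmm ⊥ r P hP
  -- the two families (D2), same `σ`
  obtain ⟨Φ, comm, hΦ, κ, hκ0, hκ⟩ := exists_derivativeFamily W p S hc red (Nat.succ_pos k) hM e hec he
    einv hic h₁ h₂ D.primes hPr hKol σ hσk h0k
  obtain ⟨Φ'', comm'', hΦ'', κ'', hκ0'', hκ''⟩ := exists_derivativeFamily W p S hc red'' (Nat.succ_pos m)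
    hM'' e'' hec'' he'' einv'' hic'' h₁'' h₂'' D''.primes hPr'' hKol'' σ hσm h0m
  -- the global transports (GZ-1), for the pull-back of the classes to `T′`, `T″`
  obtain ⟨Φ₀, hΦ₀⟩ := exists_addEquiv_oneCocycleClass T'.toTopRep
    (W.torsionGaloisModule (((p : ℕ) : ℤ) ^ k * ((p : ℕ) : ℤ))).toTopRep e hec he einv hic h₁ h₂
  obtain ⟨Φ₀'', hΦ₀''⟩ := exists_addEquiv_oneCocycleClass T''.toTopRep
    (W.torsionGaloisModule (((p : ℕ) : ℤ) ^ m * ((p : ℕ) : ℤ))).toTopRep e'' hec'' he'' einv'' hic'' h₁'' h₂''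
  -- the unramified clause for `𝓕_can` at both depths (as in D4)
  have hunr : ∀ (j : ℕ) (w : HeightOneSpectrum (𝓞 ℚ)), W.HasGoodReductionAt w →
      ((primesEquiv w : Nat.Primes) : ℕ) ≠ p →
        unramifiedSubgroup (GaloisRep.toLocal w (W.torsionGaloisModule (((p : ℕ) : ℤ) ^ j * ((p : ℕ) : ℤ)))) 1 ≤
          propagatedSelmerStructure W p j (Sum.inr w) := fun j w hw hne =>
    (propagatedSelmerStructure_inr_eq_unramifiedSubgroup W p j
      (WeierstrassCurve.natCast_not_mem_asIdeal_of_primesEquiv_ne Fact.out hne) hw).ge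
  refine ⟨σ, Φ, comm, κ, Φ'', comm'', κ'', hσI, hσχ, hΦ, hΦ'', ?_, ?_, hκ0, hκ0'',
    fun r hr => (hκ r hr).1, fun r hr => (hκ'' r hr).1, fun d hdk hdm => ?_⟩
  · -- depth `k`: THEOREM D-core (D3b); the non-good places by the three-way split
    refine isKolyvaginSystem_derivativeFamily_of_transverse_eq W p S hp2 hc red hred (Nat.succ_pos k) hM
      hmk e hec he einv hic h₁ h₂ D hT hD hPr hKol σ (fun ℓ _ => hσI ℓ) (fun ℓ _ => hσχ ℓ) hσk h0k Φ
      hΦ comm κ hκ0 (fun r hr => (hκ r hr).1) _ (hunr k) fun d hd w hwd hw => ?_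
    by_cases hwp : ((primesEquiv w : Nat.Primes) : ℕ) = p
    · rw [htop w hwp]
      exact AddSubgroup.mem_top _
    · -- `w ∤ p` (anomalous bad `w` INCLUDED): the `𝓕_u` road (no condition on the primes of `d`)
      have hκX := resSubgroup_symm_eq_noncommProd_deriv T'.toTopRep
        (W.torsionGaloisModule (((p : ℕ) : ℤ) ^ k * ((p : ℕ) : ℤ))).toTopRep e hec he einv h₁ h₂ ((𝓛).level ⊥ d)
        Φ₀ hΦ₀ (Φ d) (hΦ d) σ _ d
        (pairwise_commute_deriv (L := 𝓛) (T' := T') ⊥ d σ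
          (fun ℓ => ((primesEquiv ℓ : Nat.Primes) : ℕ) - 1)) (comm d) _ (κ d) ((hκ d hd).1)
      rw [← Φ₀.apply_symm_apply (κ d)]
      exact localization_mem_propagatedSelmerStructure_of_res_eq_deriv_of_unramified W p k hc red e hec
        (fun g x => he g x) hcompk Φ₀.toAddMonoidHom (fun φ ψ h => hΦ₀ φ ψ h)
        ⟨d, fun _ hq => hPr (hd (Finset.mem_coe.2 hq))⟩ σ Fr (hσk d hd).1 (hσk d hd).2.1 (hσk d hd).2.2
        (fun ℓ _ => hFr ℓ) (hramk d hd)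
        (fun ℓ hℓ v => natCast_sub_one_smul_eq_zero_of_isKolyvaginPrime W p k hM
          (hKol ℓ (hd (Finset.mem_coe.2 hℓ))) v)
        (fun ℓ hℓ v => eval_one_rubinEulerFactor_smul_eq_zero_of_isKolyvaginPrime W p k hM
          (hKol ℓ (hd (Finset.mem_coe.2 hℓ))) (hFr ℓ) v)
        _ (eq_zero_of_forall_level_fixed_of_equiv W p k e he einv h₁ ((𝓛).level ⊥ d) (h0k d hd))
        (Φ₀.symm (κ d)) hκX w hwd
        (fun s hs 𝔓 h𝔓 => hur ⊥ ⟨s, fun _ hq => hPr (hd (Finset.mem_coe.2 (hs hq)))⟩ w hwp 𝔓 h𝔓)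
  · -- depth `m`: the same
    refine isKolyvaginSystem_derivativeFamily_of_transverse_eq W p S hp2 hc red'' hred'' (Nat.succ_pos m)
      hM'' hmm e'' hec'' he'' einv'' hic'' h₁'' h₂'' D'' hT'' hD'' hPr'' hKol'' σ (fun ℓ _ => hσI ℓ)
      (fun ℓ _ => hσχ ℓ) hσm h0m Φ'' hΦ'' comm'' κ'' hκ0'' (fun r hr => (hκ'' r hr).1) _ (hunr m)
      fun d hd w hwd hw => ?_
    by_cases hwp : ((primesEquiv w : Nat.Primes) : ℕ) = p
    · rw [htop'' w hwp]
      exact AddSubgroup.mem_top _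
    · -- `w ∤ p`: the `𝓕_u` road at depth `m`
      have hκX := resSubgroup_symm_eq_noncommProd_deriv T''.toTopRep
        (W.torsionGaloisModule (((p : ℕ) : ℤ) ^ m * ((p : ℕ) : ℤ))).toTopRep e'' hec'' he'' einv'' h₁'' h₂''
        ((𝓛).level ⊥ d) Φ₀'' hΦ₀'' (Φ'' d) (hΦ'' d) σ _ d
        (pairwise_commute_deriv (L := 𝓛) (T' := T'') ⊥ d σ
          (fun ℓ => ((primesEquiv ℓ : Nat.Primes) : ℕ) - 1)) (comm'' d) _ (κ'' d) ((hκ'' d hd).1)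
      rw [← Φ₀''.apply_symm_apply (κ'' d)]
      exact localization_mem_propagatedSelmerStructure_of_res_eq_deriv_of_unramified W p m hc red'' e'' hec''
        (fun g x => he'' g x) hcompm Φ₀''.toAddMonoidHom (fun φ ψ h => hΦ₀'' φ ψ h)
        ⟨d, fun _ hq => hPr'' (hd (Finset.mem_coe.2 hq))⟩ σ Fr (hσm d hd).1 (hσm d hd).2.1 (hσm d hd).2.2
        (fun ℓ _ => hFr ℓ) (hramm d hd)
        (fun ℓ hℓ v => natCast_sub_one_smul_eq_zero_of_isKolyvaginPrime W p m hM''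
          (hKol'' ℓ (hd (Finset.mem_coe.2 hℓ))) v)
        (fun ℓ hℓ v => eval_one_rubinEulerFactor_smul_eq_zero_of_isKolyvaginPrime W p m hM''
          (hKol'' ℓ (hd (Finset.mem_coe.2 hℓ))) (hFr ℓ) v)
        _ (eq_zero_of_forall_level_fixed_of_equiv W p m e'' he'' einv'' h₁'' ((𝓛).level ⊥ d) (h0m d hd))
        (Φ₀''.symm (κ'' d)) hκX w hwd
        (fun s hs 𝔓 h𝔓 => hur ⊥ ⟨s, fun _ hq => hPr'' (hd (Finset.mem_coe.2 (hs hq)))⟩ w hwp 𝔓 h𝔓)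
  · -- (COMP) on the common levels
    exact map_derivativeFamily_eq W p S hkm red e hcomp red'' e'' hcomp'' π hπ (D.primes ∩ D''.primes)
      (fun ℓ hℓ => hPr hℓ.1) σ Φ hΦ comm κ (fun r hr => hκ r (hr.trans Set.inter_subset_left)) Φ'' hΦ''
      comm'' κ'' (fun r hr => (hκ'' r (hr.trans Set.inter_subset_right)).1) d
      (Set.subset_inter hdk hdm)


end Summit.BirchSwinnertonDyer.BirchSwinnertonDyer.Theorems.KimAtThreeD7uKolyvaginPairOdd

end
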